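/-
Copyright: fleet lead `ym-wcr-19609-p1` (seat prover-ym-wcr-19609-p1-g0-0), route `WeakCouplingRates`, crux
`BulkDominatesColdBoxW` (stmt-QuantumFields-19609), line `dlr-chessboard` (skeleton sha16 021c654069d76526).
-/
import Summits.QuantumFields.YangMills.Theorems.WeakCouplingRatesBulkDominatesColdBoxWDefs
import Summits.QuantumFields.YangMills.Theorems.WeakCouplingRatesLargeFieldTailAllSides

/-!
# Registered stub L2 `stub_largeFieldRarity` of crux `BulkDominatesColdBoxW` (stmt-QuantumFields-19609), BY NAME

The line `dlr-chessboard` (planner ym-beyond-p3 g13, skeleton v2 `021c654069d76526`) registers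
`stub_largeFieldRarity : ∀ δ : ℝ, 0 < δ → PlaquetteLargeFieldRarity δ` — volume-uniform large-field rarity of ONE plaquette of the
`SU(2)₄` Wilson torus states, for ALL large torus sides and EVERY exponent `δ > 0`.  The predicate lives in
`Theorems/WeakCouplingRatesBulkDominatesColdBoxWDefs.lean` (p445725); the content — even sides by link-plane reflection positivity +
the Fröhlich–Israel–Lieb–Simon chessboard estimate, odd sides by the tree's iterated site-reflection doubling on the odd torus
(`SoloBlind.wilsonExpectation_exp_plaquetteCost_le`) + crude partition-function bounds — is
`plaquetteLargeFieldRarity_eventually` of `Theorems/WeakCouplingRatesLargeFieldTailAllSides.lean` (p445390).  This file is the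
one-line identification.  NOT a statement about the mass gap.

References: [FrohlichIsraelLiebSimon1978] Thm. 4.1; E. Seiler, LNP 159 (1982) Ch. 4.
-/

set_option autoImplicit false

namespace Summit.QuantumFields.YangMills.Theorems.WeakCouplingRates

/-- **Registered stub `stub_largeFieldRarity` of crux `stmt-QuantumFields-19609` (BULK_W)** — L2 of the DLR–chessboard line, ALL torus
sides, every `δ > 0`, by name and signature. [cite: FrohlichIsraelLiebSimon1978, Thm. 4.1] -/
theorem stub_largeFieldRarity : ∀ δ : ℝ, 0 < δ → PlaquetteLargeFieldRarity δ :=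
  fun _ hδ => plaquetteLargeFieldRarity_eventually hδ

end Summit.QuantumFields.YangMills.Theorems.WeakCouplingRates
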